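import Literature.AlgebraicGeometry.Resolution.BlowupOffCentre
import Literature.AlgebraicGeometry.Resolution.BlowupsLocal
import HarnessLib

/-!
# Restriction kit: a blowing up, its exceptional ideal and its transforms, restricted over an open of the base

Topic: `Literature/AlgebraicGeometry/Resolution`. For a blowing up `τ : W' → W` along the ideal sheaf `C`
(universal property, Görtz–Wedhorn I Def. 13.90 = the tree's `IsBlowup`) and an open `U ⊆ W`, the restriction
`τ ∣_ U : τ⁻¹(U) → U` is the blowing up of `U` along `C|_U` (Görtz–Wedhorn I, Prop. 13.91 (1)–(2); tree
`IsBlowup.restrict`, NOT restated here), and every object attached to `τ` restricts along the open immersions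
`τ⁻¹(U) ↪ W'`, `U ↪ W` of the commutative square `τ⁻¹(U) ↪ W' → W = τ⁻¹(U) → U ↪ W`
(`Scheme.morphismRestrict_ι`). This file PACKAGES these restrictions in the `U.ι` / `τ ∣_ U` currency, so that
an argument available only on a neighbourhood `U` of a point of the centre (a local presentation of the centre,
simple normal crossings near a point, a principal host divisor) can be run for `τ ∣_ U` and read back on `W'`:

* `comap_comap_morphismRestrict` — `(K|_U)·𝒪_{τ⁻¹U} = (K·𝒪_{W'})|_{τ⁻¹U}` for every ideal sheaf `K` on `W`;
  in particular the exceptional ideal restricts (`K = C`);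
* `controlledTransform_morphismRestrict`, `strictTransformIdeal_morphismRestrict`,
  `transformBoundary_morphismRestrict`, `MarkedIdeal.transform_morphismRestrict` — the controlled transform
  `(τ^*I : (C𝒪_{W'})^μ)`, the strict transform `⋃ₙ (τ^*K : (C𝒪_{W'})ⁿ)`, the transformed boundary LIST
  `E.map σᶜ ++ [C𝒪_{W'}]` and the transform of a marked ideal (BGMW Def. 3.1.3 (3)–(5)) all commute with
  restriction to `τ⁻¹(U)` — the open immersion `τ⁻¹(U) ↪ W'` is flat, and colon ideal sheaves commute with flat
  base change between locally Noetherian schemes (tree `comap_controlledTransform_of_flat`, Matsumura Thm. 7.4);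
* the POINTWISE DICTIONARY along a morphism `f : V → X` whose stalk map at `v` is an isomorphism (an open
  immersion at every point; a blowing up at every point off its centre, Stacks 02OS = tree
  `IsBlowup.isIso_stalkMap_of_not_mem_support`): `stalkIdeal_comap_le_pow_iff_of_isIso_stalkMap`
  (`(I𝒪_V)_v ⊆ (J𝒪_V)_vⁿ ↔ I_{f v} ⊆ J_{f v}ⁿ` — e.g. the containment `𝔟 ⊆ C^ν` and its pointwise negation
  restrict and extend), `stalkIdeal_comap_le_iff_of_isIso_stalkMap`, `stalkIdeal_comap_eq_iff_of_isIso_stalkMap`,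
  and, for open immersions, `idealOrder_comap_of_isOpenImmersion` (`ord_v(I|_V) = ord_{f v}(I)`, BGMW
  Lemma 8.0.3 (2) = tree `idealOrder_comap_of_etale`; the iso-stalk-map form is the tree's
  `idealOrder_comap_of_isIso_stalkMap`, `Hironaka2005CompletionOrders.lean`, and the membership form of
  `support_comap` is the tree's `mem_support_comap_iff`, `BlowupDisjointCentreWeights.lean` — not restated);
* global predicates restrict along open immersions: `IsEffectiveCartier` (tree
  `IsEffectiveCartier.comap_of_isOpenImmersion`), regular centres (`Scheme.IsRegular.subscheme_comap_of_etale`),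
  simple normal crossings `HasSNCWith` (`HasSNCWith.comap_of_isOpenImmersion` = tree `HasSNCWith.comap_of_etale`),
  and the containment `I ≤ C ^ n` (`pow_le_comap`: `I ≤ C^n → I|_V ≤ (C|_V)^n`; conversely local on an open
  cover, `le_pow_of_forall_comap_ι_le_pow`, from the tree's `le_of_forall_comap_ι_le`).

Off the centre nothing needs restricting: the tree's `BlowupOffCentre.lean` already gives
`IsBlowup.idealOrder_comap_of_not_mem`, `IsBlowup.stalkIdeal_strictTransformIdeal_of_not_mem`,
`IsBlowup.idealOrder_controlledTransform_of_not_mem` (cited, not restated).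

Everything here is PROVED and fact-free; written for cell res-hironaka (crux `PatchingRelPerfect`, chain W5.2,
brick (L-B) of res-D-pv-054's Phase-A transport with boundary), but generic.

## Sources
* U. Görtz, T. Wedhorn, *Algebraic Geometry I*, 2nd ed. (2020), Def. 13.90, Prop. 13.91. [GortzWedhorn2020]
* E. Bierstone, D. Grigoriev, P. Milman, J. Włodarczyk, arXiv:1206.3090, §3.2, Def. 3.1.3 (3)–(5),
  Lemma 8.0.3 (2). [BierstoneGrigorievMilmanWlodarczyk2011]
* H. Matsumura, *Commutative Ring Theory* (1986), Thm. 7.4 (iii). [Matsumura1987]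
* The Stacks Project, Tag 02OS. [StacksProject]
-/

noncomputable section

open CategoryTheory CategoryTheory.Limits AlgebraicGeometry TopologicalSpace IsLocalRing

namespace Literature.AlgebraicGeometry.Resolution

universe u

open Scheme.IdealSheafData

/-! ## §1 Pointwise dictionary along a morphism with bijective stalk map -/

section Stalk

variable {V X : Scheme.{u}} (f : V ⟶ X)

/-- Along a ring isomorphism, `I·B ⊆ (J·B)ⁿ ↔ I ⊆ Jⁿ`. [folklore] -/
private theorem map_le_map_pow_iff_of_bijective {A B : Type*} [CommRing A] [CommRing B] (e : A →+* B)
    (he : Function.Bijective e) (I J : Ideal A) (n : ℕ) :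
    I.map e ≤ (J.map e) ^ n ↔ I ≤ J ^ n := by
  rw [← Ideal.map_pow]
  refine ⟨fun h => ?_, fun h => Ideal.map_mono h⟩
  have h' := Ideal.comap_mono (f := e) h
  rwa [Ideal.comap_map_of_bijective e he, Ideal.comap_map_of_bijective e he] at h'

/-- **`(I·𝒪_V)_v ⊆ (J·𝒪_V)_vⁿ ↔ I_{f v} ⊆ J_{f v}ⁿ` when the stalk map `𝒪_{X, f v} → 𝒪_{V, v}` is an
isomorphism** (an open immersion; a blowing up at a point off its centre, Stacks 02OS): containments between an
ideal and powers of another — `𝔟 ⊆ C^ν` read at a point, or its negation (a «maximal weight» clause) — restrict to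
`V` and extend back. [cite: StacksProject, Tag 02OS] -/
theorem stalkIdeal_comap_le_pow_iff_of_isIso_stalkMap (I J : X.IdealSheafData) (v : V) [IsIso (f.stalkMap v)]
    (n : ℕ) :
    stalkIdeal (I.comap f) v ≤ stalkIdeal (J.comap f) v ^ n ↔ stalkIdeal I (f v) ≤ stalkIdeal J (f v) ^ n := by
  rw [stalkIdeal_comap_eq_map, stalkIdeal_comap_eq_map]
  exact map_le_map_pow_iff_of_bijective _ (ConcreteCategory.bijective_of_isIso (f.stalkMap v)) _ _ n

/-- `(I·𝒪_V)_v ⊆ (J·𝒪_V)_v ↔ I_{f v} ⊆ J_{f v}` when the stalk map at `v` is an isomorphism (containments of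
stalk ideals are preserved and reflected along an isomorphism of local rings — the mechanism of «étale morphisms
preserve multiplicities», BGMW Lemma 8.0.3 (2)). [cite: BierstoneGrigorievMilmanWlodarczyk2011, Lemma 8.0.3 (2)] -/
theorem stalkIdeal_comap_le_iff_of_isIso_stalkMap (I J : X.IdealSheafData) (v : V) [IsIso (f.stalkMap v)] :
    stalkIdeal (I.comap f) v ≤ stalkIdeal (J.comap f) v ↔ stalkIdeal I (f v) ≤ stalkIdeal J (f v) := by
  simpa only [pow_one] using stalkIdeal_comap_le_pow_iff_of_isIso_stalkMap f I J v 1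

/-- `(I·𝒪_V)_v = (J·𝒪_V)_v ↔ I_{f v} = J_{f v}` when the stalk map at `v` is an isomorphism.
[cite: BierstoneGrigorievMilmanWlodarczyk2011, Lemma 8.0.3 (2)] -/
theorem stalkIdeal_comap_eq_iff_of_isIso_stalkMap (I J : X.IdealSheafData) (v : V) [IsIso (f.stalkMap v)] :
    stalkIdeal (I.comap f) v = stalkIdeal (J.comap f) v ↔ stalkIdeal I (f v) = stalkIdeal J (f v) := by
  rw [le_antisymm_iff, le_antisymm_iff, stalkIdeal_comap_le_iff_of_isIso_stalkMap,
    stalkIdeal_comap_le_iff_of_isIso_stalkMap]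

/-- `(I·𝒪_V)_v ⊆ 𝔪_vⁿ ↔ I_{f v} ⊆ 𝔪_{f v}ⁿ` when the stalk map at `v` is an isomorphism («étale morphisms
preserve multiplicities», BGMW Lemma 8.0.3 (2), in the degenerate case of an isomorphism of local rings).
[cite: BierstoneGrigorievMilmanWlodarczyk2011, Lemma 8.0.3 (2)] -/
theorem stalkIdeal_comap_le_maximalIdeal_pow_iff_of_isIso_stalkMap (I : X.IdealSheafData) (v : V)
    [IsIso (f.stalkMap v)] (n : ℕ) :
    stalkIdeal (I.comap f) v ≤ maximalIdeal (V.presheaf.stalk v) ^ n ↔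
      stalkIdeal I (f v) ≤ maximalIdeal (X.presheaf.stalk (f v)) ^ n := by
  let e : X.presheaf.stalk (f v) ≃+* V.presheaf.stalk v := (asIso (f.stalkMap v)).commRingCatIsoToRingEquiv
  have he : (e : X.presheaf.stalk (f v) →+* V.presheaf.stalk v) = (f.stalkMap v).hom := rfl
  rw [stalkIdeal_comap_eq_map, ← he, ← map_ringEquiv_maximalIdeal e]
  exact map_le_map_pow_iff_of_bijective _ e.bijective _ _ n

end Stalk

/-! ## §2 Global predicates restrict along open immersions -/

section OpenImmersion

variable {V X : Scheme.{u}} (f : V ⟶ X) [IsOpenImmersion f]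

/-- `ord_v(I|_V) = ord_{f v}(I)` along an open immersion (BGMW Lemma 8.0.3 (2) for the étale morphism `f`; tree
`idealOrder_comap_of_etale`). [cite: BierstoneGrigorievMilmanWlodarczyk2011, Lemma 8.0.3 (2)] -/
theorem idealOrder_comap_of_isOpenImmersion (I : X.IdealSheafData) (v : V) :
    idealOrder (I.comap f) v = idealOrder I (f v) :=
  idealOrder_comap_of_etale f I v

/-- `I ⊆ C ^ n` pulls back: `g^*I ⊆ (g^*C)ⁿ` (any morphism `g`) — the centre condition `𝓘 ⊆ 𝓘_C^μ` of BGMW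
Lemma 3.2.1 (1) for the pulled-back data of Thm. 8.0.5.
[cite: BierstoneGrigorievMilmanWlodarczyk2011, Lemma 3.2.1 (1) with Thm. 8.0.5] -/
theorem pow_le_comap {I C : X.IdealSheafData} {n : ℕ} (h : I ≤ C ^ n) {Y : Scheme.{u}} (g : Y ⟶ X) :
    I.comap g ≤ C.comap g ^ n := by
  rw [← comap_pow]
  exact comap_mono (f := g) h

/-- **`I ⊆ Cⁿ` is local on an open cover**: if `I|_{Vᵢ} ⊆ (C|_{Vᵢ})ⁿ` for the members of an open cover then
`I ⊆ Cⁿ` (tree `le_of_forall_comap_ι_le`; the centre condition of BGMW Lemma 3.2.1 (1) is local on the base).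
[cite: BierstoneGrigorievMilmanWlodarczyk2011, Lemma 3.2.1 (1) with Thm. 8.0.5] -/
theorem le_pow_of_forall_comap_ι_le_pow {I C : X.IdealSheafData} {n : ℕ} {ι : Type*} (W : ι → X.Opens)
    (hW : ⨆ i, W i = ⊤) (h : ∀ i, I.comap (W i).ι ≤ C.comap (W i).ι ^ n) : I ≤ C ^ n :=
  le_of_forall_comap_ι_le W hW fun i => by rw [comap_pow]; exact h i

/-- **Simple normal crossings restrict along open immersions**: `HasSNCWith E C` on `X` gives
`HasSNCWith (E|_V) (C|_V)` (BGMW Thm. 8.0.5 with Def. 3.1.3 (2) for the étale morphism `f`; tree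
`HasSNCWith.comap_of_etale`). [cite: BierstoneGrigorievMilmanWlodarczyk2011, Thm. 8.0.5 with Def. 3.1.3 (2)] -/
theorem HasSNCWith.comap_of_isOpenImmersion [IsLocallyNoetherian X] {E : List X.IdealSheafData}
    {C : X.IdealSheafData} (h : HasSNCWith E C) : HasSNCWith (E.map (·.comap f)) (C.comap f) :=
  h.comap_of_etale f

/-- **Regular centres restrict along open immersions**: `V(C|_V) = V(C) ∩ V` is regular if `V(C)` is (tree
`Scheme.IsRegular.subscheme_comap_of_etale`). [cite: BierstoneGrigorievMilmanWlodarczyk2011, Thm. 8.0.5 with Def. 3.1.3] -/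
theorem Scheme.IsRegular.subscheme_comap_of_isOpenImmersion [IsLocallyNoetherian X] {C : X.IdealSheafData}
    (hC : Scheme.IsRegular C.subscheme) : Scheme.IsRegular (C.comap f).subscheme :=
  Scheme.IsRegular.subscheme_comap_of_etale f C hC

end OpenImmersion

/-! ## §3 A blowing up restricted over an open of the base -/

section Restrict

variable {W W' : Scheme.{u}} (τ : W' ⟶ W) (U : W.Opens)

/-- **Every pulled-back ideal restricts**: `(K|_U)·𝒪_{τ⁻¹U} = (K·𝒪_{W'})|_{τ⁻¹U}`; with `K = C` the centre:
the exceptional ideal of `τ ∣_ U` is the restriction of the exceptional ideal of `τ` (Görtz–Wedhorn I, Prop. 13.91: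
the blow-up square restricted over an open of the base). [cite: GortzWedhorn2020, Prop. 13.91] -/
theorem comap_comap_morphismRestrict (K : W.IdealSheafData) :
    (K.comap U.ι).comap (τ ∣_ U) = (K.comap τ).comap (τ ⁻¹ᵁ U).ι := by
  rw [← comap_comp, ← comap_comp, morphismRestrict_ι]

/-- The blowing up `τ ∣_ U` of `U` along `C|_U` (Görtz–Wedhorn I, Prop. 13.91 (1)–(2); the tree's
`IsBlowup.restrict`, re-exported under the kit's naming for discoverability).
[cite: GortzWedhorn2020, Prop. 13.91] -/
theorem IsBlowup.morphismRestrict {C : W.IdealSheafData} (hτ : IsBlowup τ C) :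
    IsBlowup (τ ∣_ U) (C.comap U.ι) :=
  hτ.restrict U

variable [IsLocallyNoetherian W']

/-- **The controlled transform restricts**: `(τ ∣_ U)ᶜ(I|_U, μ) = (τᶜ(I, μ))|_{τ⁻¹U}` — the colon ideal sheaf
`(τ^*I : (C𝒪)^μ)` commutes with the flat base change `τ⁻¹(U) ↪ W'` (BGMW §3.2 / Def. 3.1.3 (3); tree
`comap_controlledTransform_of_flat`). [cite: BierstoneGrigorievMilmanWlodarczyk2011, §3.2 with Def. 3.1.3 (3)] -/
theorem controlledTransform_morphismRestrict (C I : W.IdealSheafData) (μ : ℕ) :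
    controlledTransform (τ ∣_ U) (C.comap U.ι) (I.comap U.ι) μ =
      (controlledTransform τ C I μ).comap (τ ⁻¹ᵁ U).ι :=
  (comap_controlledTransform_of_flat (s := (τ ⁻¹ᵁ U).ι) (π := τ) (π' := τ ∣_ U) (t := U.ι)
    (morphismRestrict_ι τ U).symm C I μ).symm

/-- **The strict transform restricts**: `⋃ₙ ((τ ∣_ U)^*(K|_U) : (C|_U 𝒪)ⁿ) = (⋃ₙ (τ^*K : (C𝒪)ⁿ))|_{τ⁻¹U}`
(Görtz–Wedhorn I, (13.19): the strict transform as schematic closure, compatible with flat base change; tree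
`comap_strictTransformIdeal_of_flat`). [cite: GortzWedhorn2020, (13.19) p. 414] -/
theorem strictTransformIdeal_morphismRestrict (C K : W.IdealSheafData) :
    strictTransformIdeal (τ ∣_ U) (C.comap U.ι) (K.comap U.ι) =
      (strictTransformIdeal τ C K).comap (τ ⁻¹ᵁ U).ι :=
  (comap_strictTransformIdeal_of_flat (s := (τ ⁻¹ᵁ U).ι) (π := τ) (π' := τ ∣_ U) (t := U.ι)
    (morphismRestrict_ι τ U).symm C K).symm

/-- **The transformed boundary LIST restricts**: the list «strict transforms of the members of `E|_U`, then the
exceptional ideal of `τ ∣_ U`» is, member by member, the restriction to `τ⁻¹(U)` of the list «strict transforms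
of the members of `E`, then the exceptional ideal of `τ`» (BGMW Def. 3.1.3 (4): `E' = σᶜ(E) ∪ {D}`).
[cite: BierstoneGrigorievMilmanWlodarczyk2011, Def. 3.1.3 (4)] -/
theorem transformBoundary_morphismRestrict (C : W.IdealSheafData) (E : List W.IdealSheafData) :
    (E.map (·.comap U.ι)).map (strictTransformIdeal (τ ∣_ U) (C.comap U.ι)) ++ [(C.comap U.ι).comap (τ ∣_ U)] =
      (E.map (strictTransformIdeal τ C) ++ [C.comap τ]).map (·.comap (τ ⁻¹ᵁ U).ι) := by
  simp only [List.map_append, List.map_map, List.map_cons, List.map_nil, comap_comap_morphismRestrict]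
  congr 1
  exact List.map_congr_left fun K _ => by
    simp only [Function.comp_apply, strictTransformIdeal_morphismRestrict]

/-- Membership form of `transformBoundary_morphismRestrict`: a member of the restricted transformed boundary is
the restriction of a member of the transformed boundary. [cite: BierstoneGrigorievMilmanWlodarczyk2011, Def. 3.1.3 (4)] -/
theorem mem_transformBoundary_morphismRestrict_iff (C : W.IdealSheafData) (E : List W.IdealSheafData)
    (D' : ((τ ⁻¹ᵁ U : W'.Opens) : Scheme.{u}).IdealSheafData) :
    D' ∈ (E.map (·.comap U.ι)).map (strictTransformIdeal (τ ∣_ U) (C.comap U.ι)) ++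
        [(C.comap U.ι).comap (τ ∣_ U)] ↔
      ∃ D ∈ E.map (strictTransformIdeal τ C) ++ [C.comap τ], D.comap (τ ⁻¹ᵁ U).ι = D' := by
  rw [transformBoundary_morphismRestrict, List.mem_map]

/-- **The transform of a marked ideal restricts** (BGMW Def. 3.1.3 (3)–(5)): the transform of
`(U, I|_U, E|_U, μ)` under `τ ∣_ U` with centre `C|_U` is the restriction to `τ⁻¹(U)` of the transform of
`(W, I, E, μ)` under `τ` with centre `C` (tree `MarkedIdeal.transform_comap_of_flat`).
[cite: BierstoneGrigorievMilmanWlodarczyk2011, Def. 3.1.3 (3)–(5)] -/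
theorem MarkedIdeal.transform_morphismRestrict (M : MarkedIdeal W) (C : W.IdealSheafData) :
    (⟨M.ideal.comap U.ι, M.boundary.map (·.comap U.ι), M.mult⟩ : MarkedIdeal U).transform (τ ∣_ U)
        (C.comap U.ι) =
      ⟨(M.transform τ C).ideal.comap (τ ⁻¹ᵁ U).ι, (M.transform τ C).boundary.map (·.comap (τ ⁻¹ᵁ U).ι),
        M.mult⟩ :=
  MarkedIdeal.transform_comap_of_flat (s := (τ ⁻¹ᵁ U).ι) (π := τ) (π' := τ ∣_ U) U.ι
    (morphismRestrict_ι τ U).symm M C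

omit [IsLocallyNoetherian W'] in
/-- **The transform law restricts**: from `τ^*𝔟 = (C𝒪)^ν · 𝔟''` on `W'` to
`(τ ∣_ U)^*(𝔟|_U) = (C|_U 𝒪)^ν · 𝔟''|_{τ⁻¹U}` on `τ⁻¹(U)` (BGMW §3.2: `σ^*𝓘 = 𝓘(D)^μ · σᶜ(𝓘, μ)`, restricted).
[cite: BierstoneGrigorievMilmanWlodarczyk2011, §3.2 with Def. 3.1.3 (3)] -/
theorem comap_morphismRestrict_eq_pow_mul_of_comap_eq {C 𝔟 : W.IdealSheafData} {𝔟'' : W'.IdealSheafData}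
    {ν : ℕ} (h : 𝔟.comap τ = C.comap τ ^ ν * 𝔟'') :
    (𝔟.comap U.ι).comap (τ ∣_ U) = (C.comap U.ι).comap (τ ∣_ U) ^ ν * 𝔟''.comap (τ ⁻¹ᵁ U).ι := by
  rw [comap_comap_morphismRestrict, comap_comap_morphismRestrict, h, comap_mul, comap_pow]

omit [IsLocallyNoetherian W'] in
/-- **Points of `τ⁻¹(U)`**: for `x' : τ⁻¹(U)`, the point `(τ ∣_ U) x'` of `U` maps to `τ x'` in `W` (the
restriction square of Görtz–Wedhorn I, Prop. 13.91, on points). [cite: GortzWedhorn2020, Prop. 13.91] -/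
theorem ι_morphismRestrict_apply (x' : ((τ ⁻¹ᵁ U : W'.Opens) : Scheme.{u})) : U.ι ((τ ∣_ U) x') = τ ((τ ⁻¹ᵁ U).ι x') := by
  rw [← Scheme.Hom.comp_apply, ← Scheme.Hom.comp_apply, morphismRestrict_ι]

/-- **Orders restrict over `U`**: `ord_{x'}((τᶜ(I, μ))|_{τ⁻¹U}) = ord_{x'}(τᶜ(I, μ))`, and the left-hand side is
the order of the controlled transform of the restricted data. [cite: BierstoneGrigorievMilmanWlodarczyk2011, Lemma 8.0.3 (2)] -/
theorem idealOrder_controlledTransform_morphismRestrict (C I : W.IdealSheafData) (μ : ℕ)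
    (x' : ((τ ⁻¹ᵁ U : W'.Opens) : Scheme.{u})) :
    idealOrder (controlledTransform (τ ∣_ U) (C.comap U.ι) (I.comap U.ι) μ) x' =
      idealOrder (controlledTransform τ C I μ) ((τ ⁻¹ᵁ U).ι x') := by
  rw [controlledTransform_morphismRestrict, idealOrder_comap_of_isOpenImmersion]

/-- The same for strict transforms: `ord_{x'}` of the strict transform of the restricted data is `ord_{x'}` of the
strict transform. [cite: BierstoneGrigorievMilmanWlodarczyk2011, Lemma 8.0.3 (2)] -/
theorem idealOrder_strictTransformIdeal_morphismRestrict (C K : W.IdealSheafData)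
    (x' : ((τ ⁻¹ᵁ U : W'.Opens) : Scheme.{u})) :
    idealOrder (strictTransformIdeal (τ ∣_ U) (C.comap U.ι) (K.comap U.ι)) x' =
      idealOrder (strictTransformIdeal τ C K) ((τ ⁻¹ᵁ U).ι x') := by
  rw [strictTransformIdeal_morphismRestrict, idealOrder_comap_of_isOpenImmersion]

/-- **Supports restrict over `U`**: `x' ∈ Supp((τ ∣_ U)ᶜ(I|_U, μ)) ↔ x' ∈ Supp(τᶜ(I, μ))` for `x' ∈ τ⁻¹(U)`
(BGMW Thm. 8.0.5 with Def. 3.1.2: supports of pulled-back data are preimages).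
[cite: BierstoneGrigorievMilmanWlodarczyk2011, Thm. 8.0.5 with Def. 3.1.2] -/
theorem mem_support_controlledTransform_morphismRestrict_iff (C I : W.IdealSheafData) (μ : ℕ)
    (x' : ((τ ⁻¹ᵁ U : W'.Opens) : Scheme.{u})) :
    x' ∈ (controlledTransform (τ ∣_ U) (C.comap U.ι) (I.comap U.ι) μ).support ↔
      (τ ⁻¹ᵁ U).ι x' ∈ (controlledTransform τ C I μ).support := by
  rw [controlledTransform_morphismRestrict, support_comap]
  rfl

/-- **Effective Cartier transforms restrict**: if `τᶜ(I, μ)` is an effective Cartier divisor on `W'`, so is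
`(τ ∣_ U)ᶜ(I|_U, μ)` on `τ⁻¹(U)` (Stacks 01WS; tree `IsEffectiveCartier.comap_of_isOpenImmersion`).
[cite: StacksProject, Tag 01WS] -/
theorem IsEffectiveCartier.controlledTransform_morphismRestrict {C I : W.IdealSheafData} {μ : ℕ}
    (h : IsEffectiveCartier (controlledTransform τ C I μ)) :
    IsEffectiveCartier (controlledTransform (τ ∣_ U) (C.comap U.ι) (I.comap U.ι) μ) := by
  rw [Resolution.controlledTransform_morphismRestrict]
  exact h.comap_of_isOpenImmersion _

end Restrict

end Literature.AlgebraicGeometry.Resolution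

end
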